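import Mathlib
import HarnessLib.Audit
import Summits.PneNP.PneNP.Theorems.PstarGateCasePUnitsCommon
import Summits.PneNP.PneNP.Theorems.PstarGateForcedShifted

/-!
# One GATED chord, CASE P with one (EQ) chord: at most four core outputs (E2 node N2X, (EQ) branch; prover-1 g21)

FRONTIER range-avoidance ladder, rung F-N3 (`stmt-PneNP-19007`), cell `pnp-ideate` (`PstarGateNodesX.GateCasePUnitsX`); restricted-model proof
complexity — nothing here bears on `P` versus `NP`.

One-gate data on an XOR-closed core, CASE P, `N = {e, e'}` with `e'` (EQ): `Q_{D e'} = q + κ'`, `q = q_{(1,0)}`.  Then `polarDir (1,0)` is the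
polar form of `Q_{D e'}` (so `q` has rank `≥ 4` and the second constraint has NO private-free gate and no linear read off `D e'`), and (P3) pins
`q̃ := q_{(0,1)} + ℓ + σ₀` to `1` on `Z(q)`, i.e. `Z(q̃) ⊆ {Q_{D e'} = κ' + 1}`.  `PstarGateForcedShifted.forced_cases_shifted` on `(D e', q̃)`:

* `q̃ ≡ 1` or `Q_{D e'} = q̃ + κ` — then the FIRST constraint has no private-free gate either and no linear read other than `u`, so no tree
  edge is private within `J₀ ∪ {g₀}` (touch lemma) and the one-gate budget gives `#J₀ ≤ 3`;
* `D e'` is a CONS-T pair `{j₁, j₂}` with a gadget `g` on its literals — a private tree edge outside `D e'` is far (its AND variables are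
  invisible to `q` and to `q̃`: `false_of_private_far`), inside `D e'` it is touched by `g` (`false_of_private_pair`); the budget with `g`
  counted (a core member, or one cross gate) gives `#J₀ ≤ 4`.

* `caseP_eq_card_le` — **CASE P with `N − e = {e'}`, `e'` (EQ): `#J₀ ≤ 5`** (indeed `≤ 4`).
-/

set_option linter.dupNamespace false -- `Summit.PneNP.PneNP.…`: summit = sub-problem name (D-0017 single-conjunct layout)

open Finset Module Literature.Computability.Complexity
open Summit.PneNP.PneNP.Theorems.PstarTyped (Typed)
open Summit.PneNP.PneNP.Theorems.PstarSALevel (varSet BoundaryExpanding SimpleOverlap)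
open Summit.PneNP.PneNP.Theorems.PstarGapLinearised (andPair andPair_subset_varSet)
open Summit.PneNP.PneNP.Theorems.PstarChordEndgameTools (mem_andPair_iff)
open Summit.PneNP.PneNP.Theorems.PstarCentreFree (vars_mem_varSet)
open Summit.PneNP.PneNP.Theorems.PstarQuadRank (rad)
open Summit.PneNP.PneNP.Theorems.PstarProductRank (qform polar)
open Summit.PneNP.PneNP.Theorems.PstarPathRank (AndAdj polar_basis)
open Summit.PneNP.PneNP.Theorems.PstarForcing (polar_unique)
open Summit.PneNP.PneNP.Theorems.PstarReadSumset (V2)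
open Summit.PneNP.PneNP.Theorems.PstarChordSystem (ChordSystem)
open Summit.PneNP.PneNP.Theorems.PstarChordBridgeTools (privs coef vars_mem_privs)
open Summit.PneNP.PneNP.Theorems.PstarChordBridge (BridgeData sys Solution Lift)
open Summit.PneNP.PneNP.Theorems.PstarChordBridgeForcing (gam freeMon rank_four_of_wf qform_add')
open Summit.PneNP.PneNP.Theorems.PstarChordBridgeBasis (qDir polarDir)
open Summit.PneNP.PneNP.Theorems.PstarChordBridgeCorner (qDir_add andAdj_iff_mem)
open Summit.PneNP.PneNP.Theorems.PstarChordBridgeFlat (qform_zero qform_single)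
open Summit.PneNP.PneNP.Theorems.PstarChordBridgeFundamental (two_le_card_of_even)
open Summit.PneNP.PneNP.Theorems.PstarNorUnitMixed (ne_of_unit)
open Summit.PneNP.PneNP.Theorems.PstarNorUnitCases (andPair_eq_of_mem)
open Summit.PneNP.PneNP.Theorems.PstarGateBridge (GateHyp)
open Summit.PneNP.PneNP.Theorems.PstarGateCasePRegimes (EqCert)
open Summit.PneNP.PneNP.Theorems.PstarGateNodes (GateData ReadAlong AllRead)
open Summit.PneNP.PneNP.Theorems.PstarGateNodesX (GateDataX)
open Summit.PneNP.PneNP.Theorems.PstarGateCasePUnitsTouch (touch_of_gateHyp not_mem_C_of_qDir polarDir_single)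
open Summit.PneNP.PneNP.Theorems.PstarGateCasePUnitsCommon
open Summit.PneNP.PneNP.Theorems.PstarGateForcedShifted (forced_cases_shifted)

namespace Summit.PneNP.PneNP.Theorems.PstarGateCasePUnitsEq

variable {n m : ℕ}

/-- Every element of `𝔽₂` is `0` or `1`. -/
private theorem z01 (t : ZMod 2) : t = 0 ∨ t = 1 := by
  revert t; decide

/-- If `polarDir (0,1)` is the polar form of the AND-sum of a core family, the first constraint has no private-free gate. -/
theorem freeMon₁_false_of_polar (I : LocalMap 4 n m) (hI : I.IsPure xorAndPred) (hS : SimpleOverlap I) {B : BridgeData n m} (hW : B.WF I)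
    (hd₁ : Disjoint B.G₁ B.J₀) {D : Finset (Fin m)} (hDJ : D ⊆ B.J₀)
    (hpol : polarDir I B (0, 1) = polar D (fun j => I.vars j 2) (fun j => I.vars j 3)) : ∀ g ∈ freeMon I B.N B.G₁, False := by
  classical
  intro g hg
  have hgJ : g ∉ B.J₀ := fun h => Finset.disjoint_left.1 hd₁ (mem_filter.1 hg).1 h
  have hT : ¬ AndAdj I B.T₁ (I.vars g 2) (I.vars g 3) := fun h => hgJ (mem_sdiff.1 (hW.hT₁ ((andAdj_iff_mem I hI hS _ g).1 h))).1
  have hF : AndAdj I (freeMon I B.N B.G₁) (I.vars g 2) (I.vars g 3) := (andAdj_iff_mem I hI hS _ g).2 hg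
  have hD : ¬ AndAdj I D (I.vars g 2) (I.vars g 3) := fun h => hgJ (hDJ ((andAdj_iff_mem I hI hS _ g).1 h))
  have h := LinearMap.congr_fun (LinearMap.congr_fun hpol (Pi.single (I.vars g 2) 1)) (Pi.single (I.vars g 3) 1)
  rw [polarDir_single, LinearMap.add_apply, LinearMap.add_apply, polar_basis I hI hS, polar_basis I hI hS, polar_basis I hI hS,
    if_neg hT, if_pos hF, if_neg hD] at h
  simp at h

/-- If `polarDir (1,0)` is the polar form of the AND-sum of a core family, the second constraint has no private-free gate. -/
theorem freeMon₂_false_of_polar (I : LocalMap 4 n m) (hI : I.IsPure xorAndPred) (hS : SimpleOverlap I) {B : BridgeData n m} (hW : B.WF I)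
    (hd₂ : Disjoint B.G₂ B.J₀) {D : Finset (Fin m)} (hDJ : D ⊆ B.J₀)
    (hpol : polarDir I B (1, 0) = polar D (fun j => I.vars j 2) (fun j => I.vars j 3)) : ∀ g ∈ freeMon I B.N B.G₂, False := by
  classical
  intro g hg
  have hgJ : g ∉ B.J₀ := fun h => Finset.disjoint_left.1 hd₂ (mem_filter.1 hg).1 h
  have hT : ¬ AndAdj I B.T₂ (I.vars g 2) (I.vars g 3) := fun h => hgJ (mem_sdiff.1 (hW.hT₂ ((andAdj_iff_mem I hI hS _ g).1 h))).1
  have hF : AndAdj I (freeMon I B.N B.G₂) (I.vars g 2) (I.vars g 3) := (andAdj_iff_mem I hI hS _ g).2 hg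
  have hD : ¬ AndAdj I D (I.vars g 2) (I.vars g 3) := fun h => hgJ (hDJ ((andAdj_iff_mem I hI hS _ g).1 h))
  have h := LinearMap.congr_fun (LinearMap.congr_fun hpol (Pi.single (I.vars g 2) 1)) (Pi.single (I.vars g 3) 1)
  rw [polarDir_single, LinearMap.add_apply, LinearMap.add_apply, LinearMap.add_apply, LinearMap.add_apply,
    polar_basis I hI hS, polar_basis I hI hS, polar_basis I hI hS, polar_basis I hI hS, polar_basis I hI hS,
    if_neg hT, if_pos hF, if_neg hD] at h
  simp at h

/-- **CASE P with one (EQ) chord: `#J₀ ≤ 5`.**  See the module docstring. -/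
theorem caseP_eq_card_le (I : LocalMap 4 n m) (hI : I.IsPure xorAndPred) (hT : Typed I) (hS : SimpleOverlap I) {r : ℕ}
    (hB : BoundaryExpanding r I) {B : BridgeData n m} {e g₀ : Fin m} {u : Fin n} {κ₀ : ZMod 2} (hD : GateDataX I r B e g₀ u κ₀)
    (hRA : ReadAlong I B e (1, 0)) (hread : AllRead I B e) {e' : Fin m} (hNe : B.N.erase e = {e'}) (hEQ : EqCert I B (B.D e')) :
    B.J₀.card ≤ 5 := by
  classical
  obtain ⟨-, hW, hr, hd₁, hd₂, hL, -, -, hG, hg₀, hgv, -, -, -, hG₁p, hcoef, hT3, hM0⟩ := id hD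
  have he : e ∈ B.N := hG.1
  obtain ⟨hN, hne, he'N, hN2⟩ := N_eq_pair he hNe
  have hJr : B.J₀.card ≤ r := (card_le_card (subset_union_left.trans subset_union_left)).trans hr
  have hg₀J : g₀ ∉ B.J₀ := fun h => Finset.disjoint_left.1 hd₁ hg₀ h
  have hgu : u ∈ varSet I g₀ := by
    rcases hgv with ⟨-, h3⟩ | ⟨h2, -⟩
    · exact h3 ▸ vars_mem_varSet I g₀ 3
    · exact h2 ▸ vars_mem_varSet I g₀ 2
  have he'G : e' ∉ B.G₁ ∪ B.G₂ := fun h => by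
    rcases mem_union.1 h with h | h
    · exact Finset.disjoint_left.1 hd₁ h (hW.hN he'N)
    · exact Finset.disjoint_left.1 hd₂ h (hW.hN he'N)
  have he'D : e' ∉ B.D e' := fun h => (mem_sdiff.1 (hW.hD e' he'N h)).2 he'N
  have hDJ : B.D e' ⊆ B.J₀ := (hW.hD e' he'N).trans sdiff_subset
  have hDne : (B.D e').Nonempty := card_pos.1 (by have := two_le_card_of_even I hI hS he'D (hW.hDeven e' he'N); omega)
  obtain ⟨κ', hκ'⟩ := hEQ
  -- the second constraint: polar form, rank, (P1), no linear reads off `D e'`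
  have hpolq : polarDir I B (1, 0) = polar (B.D e') (fun j => I.vars j 2) (fun j => I.vars j 3) :=
    (polar_unique (qform_add' I (B.D e')) (fun x w => by
      rw [hκ' (x + w), hκ' x, hκ' w, hκ' 0, qDir_add]
      generalize qDir I B (1, 0) x = s; generalize qDir I B (1, 0) w = s'; generalize qDir I B (1, 0) 0 = s₀
      generalize polarDir I B (1, 0) x w = t; generalize κ' = k
      revert s s' s₀ t k; decide)).symm
  have hrank : finrank (ZMod 2) (rad (polarDir I B (1, 0))) + 4 ≤ finrank (ZMod 2) (Fin n → ZMod 2) := by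
    rw [hpolq]; exact rank_four_of_wf I hI hS hB hW hJr he'N
  have hP1 : ∀ x, qDir I B (1, 0) x = 0 → qform (B.D e') (fun j => I.vars j 2) (fun j => I.vars j 3) x = κ' := by
    intro x hx; rw [hκ' x, hx, zero_add]
  have hq0 : ∀ v, qDir I B (1, 0) (Pi.single v 1) = qDir I B (1, 0) 0 := by
    intro v
    have h1 := hκ' (Pi.single v 1); have h0 := hκ' 0
    rw [qform_single I hI] at h1; rw [qform_zero] at h0
    have e2 : ∀ a b k : ZMod 2, 0 = a + k → 0 = b + k → a = b := by decide
    exact e2 _ _ _ h1 h0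
  have hfG₂ : ∀ g ∈ freeMon I B.N B.G₂, False := freeMon₂_false_of_polar I hI hS hW hd₂ hDJ hpolq
  -- (P3) and the shifted first form
  set σ₀ : ZMod 2 := ((sys I B).ρ e' 0 + (sys I B).ρ' e' 0).1 with hσ₀
  have hP3 := caseP_P3 I hI hT hW hL hG hN hne hT3 hRA hread
  set qt : (Fin n → ZMod 2) → ZMod 2 := fun x => qDir I B (0, 1) x + coef I B.C₁ B.G₁ (I.vars e 2) x + σ₀ with hqt
  have hqtB : ∀ x w, qt (x + w) = qt x + qt w + qt 0 + polarDir I B (0, 1) x w := qt_add I B (coef_add hcoef) σ₀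
  have hZt : ∀ x, qt x = 0 → qform (B.D e') (fun j => I.vars j 2) (fun j => I.vars j 3) x = κ' + 1 := by
    intro x hx
    rcases z01 (qDir I B (1, 0) x) with h0 | h1
    · exfalso
      have h := hP3 x h0
      have hx' : qDir I B (0, 1) x + coef I B.C₁ B.G₁ (I.vars e 2) x + σ₀ = 0 := hx
      rw [← add_assoc, hx'] at h
      exact absurd h (by decide)
    · rw [hκ' x, h1, add_comm]
  -- privacy bookkeeping
  have hvu : ∀ {π : Fin m}, π ∈ B.J₀ → (∀ j ∈ insert g₀ B.J₀, j ≠ π → I.vars π 2 ∉ varSet I j ∧ I.vars π 3 ∉ varSet I j) →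
      ∀ s : Fin 4, 2 ≤ s.val → I.vars π s ≠ u := by
    intro π hπ hpriv s hs h
    obtain ⟨h2, h3⟩ := hpriv g₀ (mem_insert_self _ _) (fun h' => hg₀J (h' ▸ hπ))
    have : s = 2 ∨ s = 3 := by
      rcases s with ⟨s, hs4⟩
      simp only [Fin.ext_iff] at *
      omega
    rcases this with rfl | rfl
    · exact h2 (h ▸ hgu)
    · exact h3 (h ▸ hgu)
  -- when the first constraint reads nothing but `u`, no tree edge is private
  have no_private : (∀ v, v ≠ u → qt (Pi.single v 1) = qt 0) → (∀ g ∈ freeMon I B.N B.G₁, False) → B.J₀.card ≤ 5 := by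
    intro hlin hfG₁
    refine (card_le_three_of_no_private I hB hD hN2 fun π hπ hpriv => ?_).trans (by norm_num)
    have hπJ : π ∈ B.J₀ := (mem_sdiff.1 hπ).1
    have hC : ∀ s : Fin 4, 2 ≤ s.val → I.vars π s ∉ B.C₁ ∧ I.vars π s ∉ B.C₂ := by
      intro s hs
      have hsu := hvu hπJ hpriv s hs
      obtain ⟨hC₁, hC₂⟩ := not_mem_C_of_qDir I hI hT hW hπ hs
      refine ⟨hC₁ ?_, hC₂ (hq0 _)⟩
      have h := hlin _ hsu
      have hc : coef I B.C₁ B.G₁ (I.vars e 2) (Pi.single (I.vars π s) 1) = coef I B.C₁ B.G₁ (I.vars e 2) 0 := by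
        have := coef_shift hcoef hsu 0; rwa [zero_add] at this
      have h' : qDir I B (0, 1) (Pi.single (I.vars π s) 1) + coef I B.C₁ B.G₁ (I.vars e 2) (Pi.single (I.vars π s) 1) + σ₀ =
          qDir I B (0, 1) 0 + coef I B.C₁ B.G₁ (I.vars e 2) 0 + σ₀ := h
      rw [hc] at h'
      have e3 : ∀ a b c s : ZMod 2, a + c + s = b + c + s → a = b := by decide
      exact e3 _ _ _ _ h'
    exact touch_of_gateHyp I hI hG hg₀J hG₁p hT3 hπJ (hM0 π hπJ) hpriv ⟨(hC 2 (by decide)).1, (hC 3 (by decide)).1, (hC 2 (by decide)).2,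
      (hC 3 (by decide)).2⟩ (fun g hg => (hfG₁ g hg).elim) (fun g hg => (hfG₂ g hg).elim)
  rcases forced_cases_shifted I hI hS hB hW hr he'N he'G (0, 1) hqtB hZt with h1 | ⟨κ, hκ⟩ |
      ⟨j₁, j₂, σ, τ, hj, hDe, hdisj, hσ, hτ, g, hg, hσg, hτg⟩
  · -- `q̃ ≡ 1`: the first constraint's polar form vanishes
    refine no_private (fun v _ => by rw [h1, h1]) ?_
    have hpol0 : polarDir I B (0, 1) = polar (∅ : Finset (Fin m)) (fun j => I.vars j 2) (fun j => I.vars j 3) := by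
      refine LinearMap.ext₂ fun x w => ?_
      have h := hqtB x w
      rw [h1, h1, h1, h1] at h
      have hp : polar (∅ : Finset (Fin m)) (fun j => I.vars j 2) (fun j => I.vars j 3) x w = 0 := by
        have := qform_add' I (∅ : Finset (Fin m)) x w
        simp only [qform, sum_empty, zero_add] at this
        exact this.symm
      rw [hp]
      have e4 : ∀ t : ZMod 2, (1 : ZMod 2) = 1 + 1 + 1 + t → t = 0 := by decide
      exact e4 _ h
    exact freeMon₁_false_of_polar I hI hS hW hd₁ (empty_subset _) hpol0
  · -- `Q_{D e'} = q̃ + κ`: the first constraint's polar form is that of `D e'`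
    have hpol1 : polarDir I B (0, 1) = polar (B.D e') (fun j => I.vars j 2) (fun j => I.vars j 3) :=
      (polar_unique (qform_add' I (B.D e')) (fun x w => by
        rw [hκ (x + w), hκ x, hκ w, hκ 0, hqtB]
        generalize qt x = s; generalize qt w = s'; generalize qt 0 = s₀
        generalize polarDir I B (0, 1) x w = t; generalize κ = k
        revert s s' s₀ t k; decide)).symm
    refine no_private (fun v _ => ?_) (freeMon₁_false_of_polar I hI hS hW hd₁ hDJ hpol1)
    have h1 := hκ (Pi.single v 1); have h0 := hκ 0
    rw [qform_single I hI] at h1; rw [qform_zero] at h0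
    have e2 : ∀ a b k : ZMod 2, 0 = a + k → 0 = b + k → a = b := by decide
    exact e2 _ _ _ h1 h0
  · -- `D e'` a CONS-T pair with a gadget `g`
    have hj₁J : j₁ ∈ B.J₀ := hDJ (by rw [hDe]; exact mem_insert_self _ _)
    have hj₂J : j₂ ∈ B.J₀ := hDJ (by rw [hDe]; exact mem_insert_of_mem (mem_singleton_self _))
    have hστ : σ ≠ τ := ne_of_unit I hdisj hσ hτ
    -- every private tree edge dies, whatever counted family `X ∋ g` contains `J₀ ∪ {g₀}`
    have main : ∀ X : Finset (Fin m), insert g₀ B.J₀ ⊆ X → g ∈ X →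
        ∀ π ∈ B.J₀ \ B.N, (∀ j ∈ X, j ≠ π → I.vars π 2 ∉ varSet I j ∧ I.vars π 3 ∉ varSet I j) → False := by
      intro X hX hgX π hπ hpriv
      have hπJ : π ∈ B.J₀ := (mem_sdiff.1 hπ).1
      by_cases hπD : π ∈ B.D e'
      · rw [hDe, mem_insert, mem_singleton] at hπD
        exact false_of_private_pair I hdisj hσ hτ hgX hσg hτg hπD hpriv
      · have hpriv' : ∀ j ∈ insert g₀ B.J₀, j ≠ π → I.vars π 2 ∉ varSet I j ∧ I.vars π 3 ∉ varSet I j :=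
          fun j hj hne' => hpriv j (hX hj) hne'
        refine false_of_private_far I hI hT hS hW hd₁ hd₂ hG hg₀ hgu hG₁p hT3 hM0 hrank hcoef hP3 hDne hP1 hπ hpriv' fun s hs => ?_
        have havoid : ∀ j ∈ B.D e', I.vars j 2 ≠ I.vars π s ∧ I.vars j 3 ≠ I.vars π s := by
          intro j hj
          have hjπ : j ≠ π := fun h => hπD (h ▸ hj)
          obtain ⟨h2, h3⟩ := hpriv' j (mem_insert_of_mem (hDJ hj)) hjπ
          have : s = 2 ∨ s = 3 := by
            rcases s with ⟨s, hs4⟩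
            simp only [Fin.ext_iff] at *
            omega
          rcases this with rfl | rfl
          · exact ⟨fun h => h2 (h ▸ vars_mem_varSet I j 2), fun h => h2 (h ▸ vars_mem_varSet I j 3)⟩
          · exact ⟨fun h => h3 (h ▸ vars_mem_varSet I j 2), fun h => h3 (h ▸ vars_mem_varSet I j 3)⟩
        refine ⟨havoid, fun w => ?_⟩
        rw [hpolq, polar_basis I hI hS, if_neg]
        rintro ⟨j, hj, ⟨-, h3⟩ | ⟨h2, -⟩⟩
        · exact (havoid j hj).2 h3
        · exact (havoid j hj).1 h2
    -- count: `g` is a core member, or one cross gate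
    by_cases hgJ : g ∈ B.J₀
    · refine (card_le_three_of_no_private I hB hD hN2 fun π hπ hpriv => ?_).trans (by norm_num)
      exact main (insert g₀ B.J₀) (Subset.refl _) (mem_insert_of_mem hgJ) π hπ hpriv
    · have hgG : g ∈ freeMon I B.N B.G₁ ∪ freeMon I B.N B.G₂ := by
        rcases mem_union.1 hg with hg | hg <;> rcases mem_union.1 hg with hg | hg
        · exact absurd (mem_sdiff.1 (hW.hT₁ hg)).1 hgJ
        · exact mem_union_left _ hg
        · exact absurd (mem_sdiff.1 (hW.hT₂ hg)).1 hgJ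
        · exact mem_union_right _ hg
      have hgG' : g ∈ B.G₁ ∪ B.G₂ := by
        rcases mem_union.1 hgG with h | h
        · exact mem_union_left _ (mem_filter.1 h).1
        · exact mem_union_right _ (mem_filter.1 h).1
      have hfree : ¬ (I.vars g 2 ∈ privs I B.N ∨ I.vars g 3 ∈ privs I B.N) := by
        rcases mem_union.1 hgG with h | h
        · exact (mem_filter.1 h).2
        · exact (mem_filter.1 h).2
      have hgg : g ≠ g₀ := by
        intro h
        subst h
        have hp : I.vars e 2 ∈ privs I B.N := vars_mem_privs I he (s := 2) (by decide)
        rcases hgv with ⟨h2, -⟩ | ⟨-, h3⟩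
        · exact hfree (Or.inl (h2 ▸ hp))
        · exact hfree (Or.inr (h3 ▸ hp))
      have hpair : andPair I g = {σ, τ} := andPair_eq_of_mem hσg hτg hστ
      have hold : (∃ j ∈ B.J₀, I.vars g 2 ∈ varSet I j) ∧ (∃ j ∈ B.J₀, I.vars g 3 ∈ varSet I j) := by
        have hmem : ∀ v ∈ andPair I g, ∃ j ∈ B.J₀, v ∈ varSet I j := by
          intro v hv
          rw [hpair, mem_insert, mem_singleton] at hv
          rcases hv with rfl | rfl
          · exact ⟨j₁, hj₁J, andPair_subset_varSet I j₁ hσ⟩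
          · exact ⟨j₂, hj₂J, andPair_subset_varSet I j₂ hτ⟩
        exact ⟨hmem _ ((mem_andPair_iff I g _).2 (Or.inl rfl)), hmem _ ((mem_andPair_iff I g _).2 (Or.inr rfl))⟩
      refine (card_le_four_of_cross I hB hD hN2 hgG' hgJ hgg hold fun π hπ hpriv => ?_).trans (by norm_num)
      exact main (insert g (insert g₀ B.J₀)) (subset_insert _ _) (mem_insert_self _ _) π hπ hpriv

end Summit.PneNP.PneNP.Theorems.PstarGateCasePUnitsEq
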